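import Mathlib
import Summits.HodgeConjecture.HodgeConjecture.Theorems.HodgeLocusCensusUnitColumnRankD4Levels
import Summits.PneNP.PneNP.Theorems.CnfIdealGenLengthRankDefectRepresentationsTwoFamilyCutDomination

/-!
# Crux `RankDefectRepresentations` (stmt-PneNP-18923), line `rank-dehn-ladder`: ONE-SIDED EXACT RELATIVE ADDITIVITY
# (lead g10; tool towards `stub_doubleMaxCutDecomposition`, memo `Lines/rank-dehn-ladder-g10.md` §2)

The only EXACT (constant-free) splitting fact known for the 2D max-cut decomposition.  In every top-down scheme over a
J-hierarchy, at level `d` the `q_d`-biclique `𝕄_B = A[(B, q_d = 0) × (Bᶜ, q_d = 1)]` (rank `≤ c`) is a block matrix over the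
depth-`d` nodes (cells); its OFF-diagonal cells lie in the region already matched by the partial answer, so their columns lie in
the restriction of the current column pool.  If a cell-local left multiplier `P = ⊕_ν P_ν` kills those pool restrictions, then
`P * 𝕄_B` is cell-diagonal, whence `Σ_ν rank (P_ν * cell_ν) = rank (P * 𝕄_B) ≤ rank 𝕄_B ≤ c`: measured modulo the pool (on the
LEFT only — no row quotient is needed), the fresh content of the level-`d` cells SUMS to at most `c` at every `B`
(`sum_rank_mul_cellBlock_le`).  This is (L2″) of the g10 memo (sharpening g9's two-sided (L2)); it is what makes fresh births
`O(c)` per level in the column-pool scheme, and it isolates the real enemy (direction splitting by forced coefficients, memo §3).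
Elementary linear algebra (rank of a direct sum of rectangular blocks, `rank_eq_sum_rank_fiber_of` from the Hodge census block
engine, and `rank (P * M) ≤ rank M`).  HONEST FRAMING: a tool; P ≠ NP is not moved; F-N2 is a FRONTIER formal rung.
-/

set_option linter.dupNamespace false -- `Summit.PneNP.PneNP.…`: summit = sub-problem name (D-0017)

namespace Summit.PneNP.PneNP.Theorems.CnfIdealGenLengthRankDefectRepresentationsRelativeAdditivity

open Matrix
open Summit.HodgeConjecture.HodgeConjecture.HodgeLocus.Census.UnitColumnRankD4Levels (rank_eq_sum_rank_fiber)

variable {K : Type} [Field K] {ι ι' γ : Type} [Fintype ι] [Fintype ι'] [Fintype γ]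
variable [DecidableEq ι] [DecidableEq ι'] [DecidableEq γ]

/-! Cells are written inline: the `(g,g)` cell of `N` (rows labelled by `rc`, columns by `cc`, zero-padded) is
`Matrix.of fun x y => if rc x = g ∧ cc y = g then N x y else 0`, and the rows of cell `g` of a pool matrix `F` are
`Matrix.of fun x j => if rc x = g then F x j else 0` (no auxiliary definitions, so that the file is a pure proof file). -/

/-- A matrix supported on the diagonal cells has rank equal to the sum of the ranks of its cells. -/
theorem rank_eq_sum_rank_cellBlock (rc : ι → γ) (cc : ι' → γ) (N : Matrix ι ι' K)
    (hdiag : ∀ x y, rc x ≠ cc y → N x y = 0) :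
    N.rank = ∑ g, ((Matrix.of fun x y => if rc x = g ∧ cc y = g then N x y else 0)).rank := by
  classical
  rw [rank_eq_sum_rank_fiber N rc cc hdiag]
  refine Finset.sum_congr rfl fun g _ => ?_
  -- the zero-padded cell has the same rank as the cell itself
  rw [Summit.PneNP.PneNP.Theorems.CnfIdealGenLengthRankDefectRepresentationsCutLemma.rank_padBlock_eq
    rc cc N (· = g) (· = g)]

omit [Fintype ι'] [Fintype γ] [DecidableEq ι] [DecidableEq ι'] in
/-- For a CELL-LOCAL left multiplier `P` (no entries between different row cells), the `(g,g)` cell of `P * M` is `P` times the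
`(g,g)` cell of `M`. -/
theorem cellBlock_mul_of_cellLocal (rc : ι → γ) (cc : ι' → γ) (P : Matrix ι ι K) (M : Matrix ι ι' K)
    (hloc : ∀ x x', rc x ≠ rc x' → P x x' = 0) (g : γ) :
    (Matrix.of fun x y => if rc x = g ∧ cc y = g then (P * M) x y else 0) = P * (Matrix.of fun x y => if rc x = g ∧ cc y = g then M x y else 0) := by
  ext x y
  simp only [Matrix.of_apply, Matrix.mul_apply]
  by_cases hy : cc y = g
  · by_cases hx : rc x = g
    · simp only [hx, hy, and_self, if_true, and_true]
      refine Finset.sum_congr rfl fun x' _ => ?_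
      by_cases hx' : rc x' = g
      · simp [hx']
      · rw [if_neg hx', hloc x x' (by rw [hx]; exact Ne.symm hx'), zero_mul, mul_zero]
    · rw [if_neg (by simp [hx])]
      symm
      refine Finset.sum_eq_zero fun x' _ => ?_
      by_cases hx' : rc x' = g
      · rw [hloc x x' (by rw [hx']; exact hx), zero_mul]
      · simp [hx']
  · rw [if_neg (by simp [hy])]
    symm
    exact Finset.sum_eq_zero fun x' _ => by simp [hy]

/-- **ONE-SIDED EXACT RELATIVE ADDITIVITY (L2″).**  If a cell-local left multiplier `P` kills every off-diagonal cell of `M`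
(`(P * M) x y = 0` whenever the row cell of `x` differs from the column cell of `y`), then the ranks of `P` times the DIAGONAL
cells of `M` sum to at most `rank M`.  (Use: `P = ⊕_ν Π_ν` with `Π_ν` a projection killing the current pool restricted to node
`ν`; then `rank (P * cell_ν)` is the rank of the cell modulo the pool, and the off-diagonal cells — already matched — are killed.) -/
theorem sum_rank_mul_cellBlock_le (rc : ι → γ) (cc : ι' → γ) (P : Matrix ι ι K) (M : Matrix ι ι' K)
    (hloc : ∀ x x', rc x ≠ rc x' → P x x' = 0) (hoff : ∀ x y, rc x ≠ cc y → (P * M) x y = 0) :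
    ∑ g, (P * (Matrix.of fun x y => if rc x = g ∧ cc y = g then M x y else 0)).rank ≤ M.rank := by
  classical
  calc ∑ g, (P * (Matrix.of fun x y => if rc x = g ∧ cc y = g then M x y else 0)).rank = ∑ g, ((Matrix.of fun x y => if rc x = g ∧ cc y = g then (P * M) x y else 0)).rank := by
        refine Finset.sum_congr rfl fun g _ => ?_; rw [cellBlock_mul_of_cellLocal rc cc P M hloc g]
    _ = (P * M).rank := (rank_eq_sum_rank_cellBlock rc cc (P * M) hoff).symm
    _ ≤ M.rank := Matrix.rank_mul_le_right P M

/-- The same with the hypothesis stated cell by cell on `M` itself: `P` restricted to the rows of cell `g` kills the columns of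
`M` lying in other column cells. -/
theorem sum_rank_mul_cellBlock_le' (rc : ι → γ) (cc : ι' → γ) (P : Matrix ι ι K) (M : Matrix ι ι' K)
    (hloc : ∀ x x', rc x ≠ rc x' → P x x' = 0)
    (hkill : ∀ x y, rc x ≠ cc y → ∑ x' ∈ Finset.univ.filter (fun x' => rc x' = rc x), P x x' * M x' y = 0) :
    ∑ g, (P * (Matrix.of fun x y => if rc x = g ∧ cc y = g then M x y else 0)).rank ≤ M.rank := by
  classical
  refine sum_rank_mul_cellBlock_le rc cc P M hloc fun x y hxy => ?_
  rw [Matrix.mul_apply, ← hkill x y hxy]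
  symm
  rw [Finset.sum_filter]
  refine Finset.sum_congr rfl fun x' _ => ?_
  by_cases h : rc x' = rc x
  · simp [h]
  · rw [if_neg h, hloc x x' (Ne.symm h), zero_mul]

omit [Fintype ι'] [Fintype γ] [DecidableEq ι] [DecidableEq ι'] in
/-- If the off-diagonal cells of `M` have their columns in the column POOL `F` restricted to the row cell (coefficients may depend
on the row cell), and the cell-local `P` kills the pool restricted to every row cell, then `P` kills the off-diagonal cells. -/
theorem mul_offDiag_eq_zero_of_pool {φ : Type} [Fintype φ] (rc : ι → γ) (cc : ι' → γ) (P : Matrix ι ι K) (M : Matrix ι ι' K)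
    (F : Matrix ι φ K) (hloc : ∀ x x', rc x ≠ rc x' → P x x' = 0) (hP : ∀ g, P * (Matrix.of fun x j => if rc x = g then F x j else 0) = 0)
    (hpool : ∀ g, ∃ C : Matrix φ ι' K, ∀ x y, rc x = g → cc y ≠ g → M x y = ∑ j, F x j * C j y) :
    ∀ x y, rc x ≠ cc y → (P * M) x y = 0 := by
  classical
  intro x y hxy
  obtain ⟨C, hC⟩ := hpool (rc x)
  have hPx : ∀ j, ∑ x', (if rc x' = rc x then P x x' * F x' j else 0) = 0 := fun j => by
    have := congrFun (congrFun (hP (rc x)) x) j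
    simpa [Matrix.mul_apply, Matrix.of_apply, mul_ite, mul_zero] using this
  rw [Matrix.mul_apply]
  calc ∑ x', P x x' * M x' y = ∑ x', ∑ j, (if rc x' = rc x then P x x' * F x' j else 0) * C j y := by
        refine Finset.sum_congr rfl fun x' _ => ?_
        by_cases h : rc x' = rc x
        · rw [hC x' y h (fun e => hxy e.symm), Finset.mul_sum]
          simp [h, mul_assoc]
        · simp [h, hloc x x' (Ne.symm h)]
    _ = ∑ j, (∑ x', (if rc x' = rc x then P x x' * F x' j else 0)) * C j y := by
        rw [Finset.sum_comm]; simp_rw [Finset.sum_mul]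
    _ = 0 := by simp [hPx]

/-- **(L2″) in pool form.**  Off-diagonal cells explained by the pool `F` (cell by cell) and a cell-local `P` killing the pool on
every row cell ⟹ `Σ_g rank (P * cell_g M) ≤ rank M`.  With `P_g` a projection whose kernel is exactly `col (rowCell g F)`,
`rank (P * cell_g M)` is the rank of the cell modulo the pool: the fresh content of the diagonal cells sums to at most `rank M`. -/
theorem sum_rank_mul_cellBlock_le_of_pool {φ : Type} [Fintype φ] (rc : ι → γ) (cc : ι' → γ) (P : Matrix ι ι K)
    (M : Matrix ι ι' K) (F : Matrix ι φ K) (hloc : ∀ x x', rc x ≠ rc x' → P x x' = 0) (hP : ∀ g, P * (Matrix.of fun x j => if rc x = g then F x j else 0) = 0)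
    (hpool : ∀ g, ∃ C : Matrix φ ι' K, ∀ x y, rc x = g → cc y ≠ g → M x y = ∑ j, F x j * C j y) :
    ∑ g, (P * (Matrix.of fun x y => if rc x = g ∧ cc y = g then M x y else 0)).rank ≤ M.rank :=
  sum_rank_mul_cellBlock_le rc cc P M hloc (mul_offDiag_eq_zero_of_pool rc cc P M F hloc hP hpool)

end Summit.PneNP.PneNP.Theorems.CnfIdealGenLengthRankDefectRepresentationsRelativeAdditivity
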